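import Summits.QuantumFields.BalabanUV.T4Continuum.Support.AveragingDeficitKDatum
import Summits.QuantumFields.BalabanUV.T4Continuum.Support.MinimalActionRefine
import HarnessLib

/-!
# T⁴ programme, node NE3 (η-rate of the minimisers) — dictionary for the variational hypothesis (H∃):
# SUP-FORM REGULARITY `RegularSup` FROM LOCAL EXPONENTIAL GAUGES WITH THE THREE PRINTED SUP BOUNDS
# (B11 Theorem 1 (8) + (9)_{β=1} TYPE data ⇒ the `RegularSup` slot of the action sandwich's END)

NE3 prover lineage P1, gen 18 (cell `pub-balaban`, unit `b2b-balaban-t4-ne3-p1`, `HOME/BINDER-OWNERS.md` row NE3 OWNER;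
sub-row S3-H∃ item (b) of the owner's RULING journal l.10091 + CORRECTION l.10124).

WHY.  Route (A)'s END `MinimalActionThm1Type.actionRate_sfClass_thm1Type` consumes (H∃): one minimiser per level with
`RegularSup d L N b c k U` — unitary, `(N·L^k)`-periodic, `SmallField U (b(L^k)^{−2})`, and the POINTWISE covariant
flux-gradient bound `‖(∇_U F)(x,κ;π)‖ ≤ c(L^k)^{−3}`.  [Balaban1985Variational] Thm 1 p. 279 prints, for the minimal
configuration, the radius (8) and — on every print-admissible cube, in a gauge `u` — `U^{u⁻¹} = e^{iηA}` with
`|A| < B₃Mε₁(L^jη)^{−1}`, `|∇^ηA| < B₃Mε₁(L^jη)^{−2}` and the Hölder bound `‖A‖_{1,β} < B₄(β₀)Mε₁(L^jη)^{−2−β}`, `β ≤ β₀ = 1`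
((9); at `β = 1` a SUP bound on ALL second differences of `A`).  In lattice units (bond variable `a = ηA`, top level
`L^kη = 1`) these are three numbers `α₀ = O(ε₁η)`, `α₁ = O(ε₁η²)`, `α₂ = O(ε₁η³)`.  Row NE3-R2's POINTWISE expansion
`AveragingDeficitFluxExpansion.norm_covGrad_flux_le` (p213056) bounds `‖(∇_V F)(x,κ;μν)‖` in such a gauge by
`‖∇_μ∇_κ a_ν(x) − ∇_ν∇_κ a_μ(x)‖ + kRem(α₀, α₁)` with `kRem = O(α₀α₁ + α₁² + α₀³) = O(ε₁²η³)`.  THIS FILE (0 def, 0 sorry) turns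
«a local exponential gauge with the three sup bounds about EVERY site» into `RegularSup`:

* `norm_covGrad_flux_le_of_localGauge` — one site: gauge invariance of `‖∇_U F‖` (`AveragingDeficitKDatum.covGrad_flux_gaugeAct`
  + `norm_Ad_of_unitary`) + the expansion ⇒ `‖(∇_U F)(x,κ;π)‖ ≤ 2α₂ + kRem α₀ α₁`;
* **`regularSup_of_localGauge`** — unitary, periodic, `SmallField U (b/(L^k)²)` with `b ≤ 1/2`, the gauge data at every site
  with `α₀, α₁ ≤ 1/8`, and the scale bookkeeping `(2α₂ + kRem α₀ α₁)·(L^k)³ ≤ c` ⇒ `RegularSup d L N b c k U`.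

The gauge datum is a HYPOTHESIS (Thm 1 (9)_{β=1} TYPE, asserted for no configuration); no `def … : Prop`; `ExpGauge`'s
Laplacian slot (the ℓ² route of `AveragingDeficitKDatum*`) is not used.  What remains for the full print discharge of (H∃)
(crew sub-row S3-H∃ items (a), (c)): the re-instantiation of r2's `torusVP.OnMinimalOrbit` at the class radius ε₀ with
`InU (B₃ε₁)` and this datum, and the arithmetic `(2α₂ + kRem)·L^{3k} ≤ c` at the printed sizes.

HONEST FRAMING.  Dictionary bookkeeping; **NE3 is NOT proved**; nothing printed is a hypothesis of a theorem; no
conditional of the cell (`BetaPertH`, (B), (B^μ), G-an2-4) occurs; no `def`, no `sorry`, axioms ⊆ {propext, Classical.choice,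
Quot.sound}.  Finite T⁴ rung (B)+1 — NOT infinite volume, NOT a mass gap, NOT the Clay problem, NOT summit progress.
PLACEMENT (human rule 2026-08-19): `Summits/QuantumFields/BalabanUV/`.  HONEST DEPENDENCY (cell page 1): continuum YM on
T⁴ ⇐ BetaPertH ∧ nine spine estimates (0/9 proved); BetaPertH ⇐ (D1) ∧ (D4) ∧ CAP+tail; G-an2-4 gates asym, D1 and NE2/3/4.
-/

set_option autoImplicit false

open scoped BigOperators Matrix.Norms.L2Operator
open NormedSpace

namespace Summit.QuantumFields.BalabanUV.T4Continuum.RegularSupOfGauge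

open Literature.MathematicalPhysics.QuantumFieldTheory.Balaban1983to89
open B7Prop1Explicit B7Prop2Explicit MatrixLog UnitaryModel
open T4AveragingDeficitWall hiding Site Plane Plaq Bond
open T4AveragingDeficitWallBoundary (IsPeriodicCfg)
open AveragingDeficitTransport (norm_Ad_of_unitary)
open AveragingDeficitLatticeH2Prep (fd)
open AveragingDeficitFluxExpansion (norm_covGrad_flux_le kRem_nonneg)
open AveragingDeficitKDatum (kRem covGrad_flux_gaugeAct isUnitaryCfg_gaugeAct)
open MinimalActionRefine (RegularSup)

noncomputable section

variable {d : ℕ} {n : Type*} [Fintype n] [DecidableEq n] [Nonempty n]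

/-! ## §1 One site: the pointwise bound in a local exponential gauge -/

/-- **THE COVARIANT FLUX GRADIENT AT ONE BOND FROM A LOCAL EXPONENTIAL GAUGE.**  Let `U` be `U(N)`-valued with plaquettes
within `a < 1` of the identity at `x` and `x + e_κ`.  If after a unitary gauge transformation `u` one has `U^u(b) = exp a(b)`
on the bonds `b = (y, τ)` with `|y − x|₁ ≤ 2`, with `‖a‖ ≤ α₀` there, first differences `‖∇_i a_τ(y)‖ ≤ α₁` for
`|y − x|₁ ≤ 1`, and second differences `‖∇_i∇_l a_τ(x)‖ ≤ α₂` at `x` (`α₀, α₁ ≤ 1/8`), then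
`‖(∇_U F)(x,κ;π)‖ ≤ 2α₂ + kRem α₀ α₁`. [folklore] -/
theorem norm_covGrad_flux_le_of_localGauge {U : Site d → Fin d → (Matrix n n ℂ)ˣ} (hU : IsUnitaryCfg U)
    {x : Site d} {κ : Fin d} {π : T4AveragingDeficitWall.Plane d}
    (hp : ‖((fhol U (x, π) : (Matrix n n ℂ)ˣ) : Matrix n n ℂ) - 1‖ < 1)
    (hp' : ‖((fhol U (x + e κ, π) : (Matrix n n ℂ)ˣ) : Matrix n n ℂ) - 1‖ < 1)
    {α₀ α₁ α₂ : ℝ} (hα₀ : 0 ≤ α₀) (hα₁ : 0 ≤ α₁) (hα₀' : α₀ ≤ 1 / 8) (hα₁' : α₁ ≤ 1 / 8)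
    {u : Site d → (Matrix n n ℂ)ˣ} (hu : ∀ z, u z ∈ unitaryUnits (Matrix n n ℂ))
    {a : Site d → Fin d → Matrix n n ℂ}
    (hexp : ∀ (y : Site d) (τ : Fin d), l1 (y - x) ≤ 2 →
      ((gaugeAct u U y τ : (Matrix n n ℂ)ˣ) : Matrix n n ℂ) = exp (a y τ))
    (h0 : ∀ (y : Site d) (τ : Fin d), l1 (y - x) ≤ 2 → ‖a y τ‖ ≤ α₀)
    (h1 : ∀ (y : Site d) (τ i : Fin d), l1 (y - x) ≤ 1 → ‖fd i (fun z => a z τ) y‖ ≤ α₁)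
    (h2 : ∀ (τ i l : Fin d), ‖fd i (fd l (fun z => a z τ)) x‖ ≤ α₂) :
    ‖covGrad U (flux U) x κ π‖ ≤ 2 * α₂ + kRem α₀ α₁ := by
  obtain ⟨⟨μ, ν⟩, hlt⟩ := π
  -- gauge invariance of the norm
  have hcov := covGrad_flux_gaugeAct hu U x κ ⟨(μ, ν), hlt⟩ hp hp'
  have hnorm : ‖covGrad U (flux U) x κ ⟨(μ, ν), hlt⟩‖
      = ‖covGrad (gaugeAct u U) (flux (gaugeAct u U)) x κ ⟨(μ, ν), hlt⟩‖ := by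
    rw [hcov, norm_Ad_of_unitary (hu x)]
  rw [hnorm]
  -- the pointwise expansion in the gauge
  have hmain := norm_covGrad_flux_le (isUnitaryCfg_gaugeAct hu hU) hα₀ hα₁ hα₀' hα₁' hexp h0 h1 κ μ ν hlt
  have hsec : ‖fd μ (fd κ (fun z => a z ν)) x - fd ν (fd κ (fun z => a z μ)) x‖ ≤ 2 * α₂ := by
    refine (norm_sub_le _ _).trans ?_
    have e1 := h2 ν μ κ
    have e2 := h2 μ ν κ
    linarith
  have hk : 16 * α₀ * α₁ + 2 * Beta.TransportVertices.expTail 3 (4 * α₀)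
      + 2 * expRem (2 * (2 * α₁ + expRem (4 * α₀))) + 4 * (Real.exp α₀ - 1) * (2 * α₁ + expRem (4 * α₀))
      = kRem α₀ α₁ := rfl
  rw [hk] at hmain
  linarith

/-! ## §2 All sites: `RegularSup` from local exponential gauges -/

/-- **SUP-FORM REGULARITY FROM LOCAL EXPONENTIAL GAUGES** (B11 Thm 1 (8) + (9)_{β=1} TYPE data ⇒ `RegularSup`): if `U` is
`U(N)`-valued, `(N·L^k)`-periodic, `SmallField U (b/(L^k)²)` with `b ≤ 1/2`, and about EVERY site `x` there is a unitary gauge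
`u` with `U^u = exp a` on the bonds within `|·|₁ ≤ 2` of `x`, `‖a‖ ≤ α₀`, `‖∇a‖ ≤ α₁` (within `1`), `‖∇∇a(x)‖ ≤ α₂`
(`α₀, α₁ ≤ 1/8`), and `(2α₂ + kRem α₀ α₁)·(L^k)³ ≤ c`, then `RegularSup d L N b c k U`. [folklore] -/
theorem regularSup_of_localGauge {L N k : ℕ} (hL : 1 ≤ L) {b c α₀ α₁ α₂ : ℝ}
    {U : Site d → Fin d → (Matrix n n ℂ)ˣ} (hU : IsUnitaryCfg U) (hP : IsPeriodicCfg U ((N * L ^ k : ℕ) : ℤ))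
    (hS : SmallField U (b / ((L : ℝ) ^ k) ^ 2)) (hb : b ≤ 1 / 2)
    (hα₀ : 0 ≤ α₀) (hα₁ : 0 ≤ α₁) (hα₀' : α₀ ≤ 1 / 8) (hα₁' : α₁ ≤ 1 / 8)
    (hgauge : ∀ x : Site d, ∃ (u : Site d → (Matrix n n ℂ)ˣ) (a : Site d → Fin d → Matrix n n ℂ),
      (∀ z, u z ∈ unitaryUnits (Matrix n n ℂ)) ∧
      (∀ (y : Site d) (τ : Fin d), l1 (y - x) ≤ 2 →
        ((gaugeAct u U y τ : (Matrix n n ℂ)ˣ) : Matrix n n ℂ) = exp (a y τ)) ∧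
      (∀ (y : Site d) (τ : Fin d), l1 (y - x) ≤ 2 → ‖a y τ‖ ≤ α₀) ∧
      (∀ (y : Site d) (τ i : Fin d), l1 (y - x) ≤ 1 → ‖fd i (fun z => a z τ) y‖ ≤ α₁) ∧
      (∀ (τ i l : Fin d), ‖fd i (fd l (fun z => a z τ)) x‖ ≤ α₂))
    (hc : (2 * α₂ + kRem α₀ α₁) * ((L : ℝ) ^ k) ^ 3 ≤ c) :
    RegularSup d L N b c k U := by
  have hL1 : (1 : ℝ) ≤ L := by exact_mod_cast hL
  have hs1 : (1 : ℝ) ≤ ((L : ℝ) ^ k) ^ 2 := one_le_pow₀ (one_le_pow₀ hL1)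
  have hs3 : (0 : ℝ) < ((L : ℝ) ^ k) ^ 3 := by positivity
  -- every plaquette is within `b ≤ 1/2 < 1` of the identity
  have hplaq : ∀ (y : Site d) (π : T4AveragingDeficitWall.Plane d),
      ‖((fhol U (y, π) : (Matrix n n ℂ)ˣ) : Matrix n n ℂ) - 1‖ < 1 := by
    intro y π
    have h := hS y π.1.1 π.1.2 (ne_of_lt π.2)
    have hb' : b / ((L : ℝ) ^ k) ^ 2 ≤ b ⊔ 0 := by
      rcases le_or_gt 0 b with hb0 | hb0
      · exact (div_le_self hb0 hs1).trans (le_max_left _ _)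
      · exact (div_nonpos_of_nonpos_of_nonneg hb0.le (by positivity)).trans (le_max_right _ _)
    have hlt : b ⊔ 0 < 1 := max_lt (by linarith) one_pos
    exact lt_of_le_of_lt (h.trans hb') hlt
  refine ⟨hU, hP, hS, fun x κ π => ?_⟩
  obtain ⟨u, a, hu, hexp, h0, h1, h2⟩ := hgauge x
  have hpt := norm_covGrad_flux_le_of_localGauge hU (hplaq x π) (hplaq (x + e κ) π) hα₀ hα₁ hα₀' hα₁' hu hexp h0 h1 h2
  rw [le_div_iff₀ hs3]
  exact (mul_le_mul_of_nonneg_right hpt hs3.le).trans hc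

end

end Summit.QuantumFields.BalabanUV.T4Continuum.RegularSupOfGauge
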